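import Summits.ValiantsHypothesis.ValiantsHypothesis.Theorems.LacunarySymmetroidMatrixDescartesCensusFullAlternation

/-!
# `MatrixDescartes` census — F1 (full alternation) for a polynomial that is Descartes-sharp WITH MULTIPLICITY

HONEST FRAMING.  Object-search cell `pub-symmetroid`, item `DoorA26 = PosRootLawAt 2 6 19` (stmt-ValiantsHypothesis-19979,
OPEN, typed, never asserted).  The `countP` twins of the three sign lemmas of `…CensusFullAlternation` (which assume
`#supp f ≤ #Z₊^{distinct}(f) + 1`): here the hypothesis is `#supp f ≤ #Z₊^{mult}(f) + 1` (positive roots counted with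
multiplicity, Mathlib's `Polynomial.roots_countP_pos_le_signVariations`), the currency of hull-edge forms of degenerating
Descartes-sharp pencils (W4, engine-1 g17–g20) whose roots may merge in the limit.  Consumers: `…CensusBoundaryParity`.
Nothing here bears on `ζ_sym`, `DoorA26`, the crux `MatrixDescartes` (stmt-ValiantsHypothesis-18050) or `VP ≠ VNP`.

[folklore] Descartes' rule of signs with multiplicity; no single source.
-/

-- `Summit.ValiantsHypothesis.ValiantsHypothesis.…` repeats a component by the D-0017 layout
-- (single-conjunct summit), which the `dupNamespace` linter flags; the name is mandated.
set_option linter.dupNamespace false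

namespace Summit.ValiantsHypothesis.ValiantsHypothesis.Theorems.LacunarySymmetroidMatrixDescartes.Census

open Polynomial Finset
open scoped BigOperators Polynomial

/-! ### F1 with multiplicity -/

/-- Consecutive support coefficients of a polynomial that is Descartes-sharp WITH MULTIPLICITY alternate strictly in
sign. [folklore] -/
theorem coeff_mul_coeff_neg_of_sharp_countP (f : ℝ[X])
    (hZ : f.support.card ≤ f.roots.countP (fun x => 0 < x) + 1)
    {a b : ℕ} (ha : a ∈ f.support) (hb : b ∈ f.support) (hab : a < b)
    (hcons : ∀ c ∈ f.support, ¬ (a < c ∧ c < b)) : f.coeff a * f.coeff b < 0 := by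
  have hf : f ≠ 0 := by rintro rfl; simp at ha
  have h1 := f.roots_countP_pos_le_signVariations
  have h2 := Literature.Computability.AlgebraicComplexity.signVariations_lt_card_support hf
  exact coeff_mul_coeff_neg_of_signVariations _ f rfl (by omega) a ha b hb hab hcons

/-- F1, rank-parity form, for a polynomial that is Descartes-sharp with multiplicity. [folklore] -/
theorem pow_neg_one_mul_coeff_mul_coeff_pos_of_sharp_countP (f : ℝ[X])
    (hZ : f.support.card ≤ f.roots.countP (fun x => 0 < x) + 1) :
    ∀ (n : ℕ) {a b : ℕ}, a ∈ f.support → b ∈ f.support → a ≤ b →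
      (f.support.filter (fun c => a < c ∧ c ≤ b)).card = n →
        0 < (-1 : ℝ) ^ n * (f.coeff a * f.coeff b) := by
  intro n
  induction n using Nat.strong_induction_on with
  | _ n ih =>
    intro a b ha hb hab hn
    rcases hab.eq_or_lt with rfl | hlt
    · have : n = 0 := by
        rw [← hn, Finset.card_eq_zero, Finset.filter_eq_empty_iff]
        intro c _ h; omega
      subst this
      have hca : f.coeff a ≠ 0 := mem_support_iff.mp ha
      simpa using mul_self_pos.mpr hca
    · have hne : (f.support.filter (fun c => a ≤ c ∧ c < b)).Nonempty := ⟨a, by simp [ha, hlt]⟩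
      set c := (f.support.filter (fun c => a ≤ c ∧ c < b)).max' hne with hc
      have hcmem : c ∈ f.support.filter (fun c => a ≤ c ∧ c < b) := Finset.max'_mem _ hne
      simp only [Finset.mem_filter] at hcmem
      obtain ⟨hcs, hac, hcb⟩ := hcmem
      have hcons : ∀ x ∈ f.support, ¬ (c < x ∧ x < b) := by
        intro x hx ⟨h1, h2⟩
        have : x ≤ c := Finset.le_max' _ x (by simp [hx, h2]; omega)
        omega
      have hstep := coeff_mul_coeff_neg_of_sharp_countP f hZ hcs hb hcb hcons
      have hsplit : (f.support.filter (fun x => a < x ∧ x ≤ b)).card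
          = (f.support.filter (fun x => a < x ∧ x ≤ c)).card + 1 := by
        have : f.support.filter (fun x => a < x ∧ x ≤ b)
            = insert b (f.support.filter (fun x => a < x ∧ x ≤ c)) := by
          ext x
          simp only [Finset.mem_filter, Finset.mem_insert]
          constructor
          · rintro ⟨hx, h1, h2⟩
            by_cases hxb : x = b
            · exact Or.inl hxb
            · right
              refine ⟨hx, h1, ?_⟩
              by_contra hxc
              exact hcons x hx ⟨by omega, by omega⟩
          · rintro (rfl | ⟨hx, h1, h2⟩)
            · exact ⟨hb, hlt, le_rfl⟩
            · exact ⟨hx, h1, by omega⟩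
        rw [this, Finset.card_insert_of_notMem]
        simp only [Finset.mem_filter, not_and, not_le]
        intro _ _; exact hcb
      set m := (f.support.filter (fun x => a < x ∧ x ≤ c)).card with hm
      have hmn : m < n := by omega
      have hprev := ih m hmn ha hcs hac rfl
      rw [← hn, hsplit, pow_succ]
      have hcc : 0 < f.coeff c * f.coeff c := mul_self_pos.mpr (mem_support_iff.mp hcs)
      nlinarith [hprev, hstep, hcc, sq_nonneg ((-1 : ℝ) ^ m)]

/-- **F1, global rank form, with multiplicity.**  If `#supp f ≤ #Z₊^{mult}(f) + 1` then for any two support exponents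
`0 < (−1)^{rank a + rank b} · coeff a · coeff b`. [folklore] -/
theorem pow_rank_mul_coeff_mul_coeff_pos_of_sharp_countP (f : ℝ[X])
    (hZ : f.support.card ≤ f.roots.countP (fun x => 0 < x) + 1)
    {a b : ℕ} (ha : a ∈ f.support) (hb : b ∈ f.support) :
    0 < (-1 : ℝ) ^ ((f.support.filter (fun c => c < a)).card + (f.support.filter (fun c => c < b)).card)
      * (f.coeff a * f.coeff b) := by
  wlog hab : a ≤ b generalizing a b
  · have := this hb ha (le_of_not_ge hab)
    rwa [add_comm, mul_comm (f.coeff b)] at this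
  have hcount := card_filter_Ioc_add_rank_eq_rank f.support ha hb hab
  have key := pow_neg_one_mul_coeff_mul_coeff_pos_of_sharp_countP f hZ _ ha hb hab rfl
  have hpow : (-1 : ℝ) ^ ((f.support.filter (fun c => c < a)).card + (f.support.filter (fun c => c < b)).card)
      = (-1 : ℝ) ^ (f.support.filter (fun c => a < c ∧ c ≤ b)).card := by
    rw [← hcount, ← add_assoc, add_comm, ← add_assoc, pow_add, ← two_mul, pow_mul]
    norm_num
  rw [hpow]
  exact key


end Summit.ValiantsHypothesis.ValiantsHypothesis.Theorems.LacunarySymmetroidMatrixDescartes.Census
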